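/-
Origin: expansion seat `prover-pub-hodgecm-mc-binder-2-0`, handover #2 2026-08-18T17:37Z md5 81ce8f11da5e (STATUS-only HANDOVER L5179; packager row) (`HOME/mc/pub-hodgecm-mc-binder-2/lean/McBinder2/ArchCHyperbolicLevi.lean`, md5 81ce8f11, 156 lines);
landed by the packager successor (mc-unitary-1-g3, gen-8 kit) in gate run 32 as `HodgeCM/PerL34/ArchCHyperbolicLevi.lean` (verbatim).
-/
/-
Origin: HOME/mc/pub-hodgecm-mc-binder-2/lean/McBinder2/ArchCHyperbolicLevi.lean — session prover-pub-hodgecm-mc-binder-2-0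
(unit pub-hodgecm-mc-binder-2, MODEL-CONSTRUCTION sub-cell, BINDER PROVER; binder row A12/A34 = node N29, seam S4).
Compiled and completed from the UNCOMPILED DRAFT banked by the retired N29 lineage seat pv06-g8
(`HOME/pub-hodgecm-pv06-g8/sketch/ArchCHyperbolicLevi.draft.lean`, 2026-08-18T17:25Z, "RUN-32 junction", HANDOFF §4(a)),
against the in-place RUN-31 package.  Intended final place: `HodgeCM/PerL34/ArchCHyperbolicLevi.lean` (or
`HodgeCM/Model/Binders/ArchCHyperbolicLevi.lean`; tree target `Summits/HodgeConjecture/PerL/PerL34/ArchCHyperbolicLevi.lean`,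
class S).  Imports three LANDED RUN-31 modules only.  KERNEL, additive leaf: nothing cited enters as a hypothesis; no
statement of PerL / QW8 / the 2001 programme is stated, assumed or cited.
-/
import Summits.HodgeConjecture.HodgeCM.PerL34.ArchCHyperbolicJunction
import Summits.HodgeConjecture.HodgeCM.Automorphic.SchwartzWeilLeviSmooth
import Summits.HodgeConjecture.HodgeCM.Automorphic.SchwartzExpFlowInvol

/-!
# The Σ₁₂ smooth-vector clause for the CONSTRUCTED Levi factor along the hyperbolic one-parameter group
# (binder A12/A34 · node N29 · seam S4 · residual field `smooth` of `ArchC.HypSmoothSide`)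

After RUN 31 the A12/A34 binders (`Nonempty (ArchCDatum …)`, PerL34/ArchC.lean) of the END STATE are reduced BY NAME to
pv06-g7's six-field 𝒯-free record `ArchC.HypSmoothSide` (`PerL34/ArchCHyperbolicSide.lean`): `FinIdx, ins, dense,
omg_ins, e, smooth`, whose only ANALYTIC clause is `smooth` — ONE Schwartz-topology derivative per place of type Σ₁₂,
along the hyperbolic direction `X₁ = E₀₁ + E₁₀ ∈ 𝔲(1,1)`.  pv06-g7's `ArchCHyperbolicJunction` (RUN 31) proves that
clause for the COMPOSITION flow `Φ ↦ Φ ∘ hypRotE s` on the Schrödinger images `hermiteSchwartz (binv F)` of the Fock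
polynomials.  This file proves it for the package's CONSTRUCTED Levi factor of the Schrödinger-model Weil representation,
pv14's `HodgeCM.SchwartzWeil.leviCLM E6 g : 𝓢(E6, ℂ) →L[ℂ] 𝓢(E6, ℂ)`, `L_g Φ = Φ ∘ g⁻¹`
(`Automorphic/SchwartzWeilLevi.lean:130`; `(λ_g, L_g) ∈ Mp_m(E6)`, `levi_mem_mpGroup`), along the hyperbolic subgroup
`s ↦ hypRotE s`:

* `hypRotE_eq_involFlow`, `hypRotE_eq_expFlow` — the hyperbolic rotation `hypRotE : ℝ → E6 ≃L[ℝ] E6` of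
  `ArchCHyperbolicSchwartz` IS pv14-g6's exponential one-parameter group `expFlow hypVelE` (`hypRotE_eq_cosh_add_sinh`,
  `hypVelE_mul_self : hypVelE² = 1`, `eq_involFlow_of_coe_eq`, `expFlow_eq_involFlow`);
* `leviCLM_hypRotE_apply` — `L_{hypRotE s} Φ = Φ ∘ expFlow (-hypVelE) s`: the generator's SIGN FLIPS relative to the
  composition flow;
* **`tendsto_leviCLM_hypRotE_hermiteSchwartz_sub_div`** — for every polynomial `p`,
  `((s:ℂ))⁻¹ • (L_{hypRotE s} (hermiteSchwartz p) − hermiteSchwartz p) ⟶ −hermiteSchwartz (hypSymb p)` in `𝓢(E6, ℂ)`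
  as `s → 0`, `s ≠ 0`;
* **`tendsto_leviCLM_hypRotE_hermiteSchwartz_binv_sub_div`** — on the Schrödinger images of the Fock polynomials the
  limit is `−hermiteSchwartz (binv (printedHyp lamF F))`: pv12's printed Fock operator of `X₁` (Folland's scaling
  `λ_F = i/π`), transported by pv05's Bargmann dictionary (`binv_printedHyp`), with the sign of the inverse;
* `hasDerivAt_apply_leviCLM_hypRotE` — consequently every real-linear continuous functional of
  `s ↦ L_{hypRotE s} (hermiteSchwartz p)` is differentiable at every `s₀` (pv14-g6's `hasDerivAt_apply_leviCLM_expFlow`).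

HONEST LABEL.  What remains NON-kernel for the `smooth` field at a Σ₁₂ place after this file is ONLY the model
identification [SETUP D4]: that the CONSTRUCTED adelic `ω(exp sX₁)` acts on the image of `ins` through the archimedean
Levi operator `L_{hypRotE (±s)}` (a property of the restricted-tensor-product model O1 of MODEL-SCOPE.md, not of PerL).
The other five fields of `HypSmoothSide` (`FinIdx, ins, dense, omg_ins, e`) are D4/D5 wiring of that model; `omg_ins` at
the pinned vacuum characters is BINDER-TRIAGE's Γ1b.  Nothing archimedean about PerL's parameters is proved here.
-/

set_option autoImplicit false

noncomputable section

namespace HodgeCM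
namespace PerL34
namespace Fock
namespace PrintDict

open Filter Topology MvPolynomial
open HodgeCM.PerL34.Fock.Hermite HodgeCM.SchwartzWeil

/-- `hypRotE` is the involutive flow of `hypVelE` (matrices `cosh s · 1 + sinh s · hypVelE`). -/
theorem hypRotE_eq_involFlow : hypRotE = involFlow hypVelE hypVelE_mul_self :=
  eq_involFlow_of_coe_eq hypVelE_mul_self hypRotE_eq_cosh_add_sinh

/-- **`hypRotE = expFlow hypVelE`**: the hyperbolic rotation is the exponential one-parameter group
`s ↦ exp(s · hypVelE)` of pv14-g6's `SchwartzExpFlow`. -/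
theorem hypRotE_eq_expFlow : hypRotE = expFlow hypVelE := by
  rw [hypRotE_eq_involFlow, expFlow_eq_involFlow hypVelE hypVelE_mul_self]

/-- (Ported verbatim from the HodgeCMPerL package; no docstring in the source.) -/
theorem hypRotE_eq_expFlow_apply (s : ℝ) : hypRotE s = expFlow hypVelE s := by
  rw [hypRotE_eq_expFlow]

/-- The constructed Levi factor along the hyperbolic subgroup is composition with the INVERSE flow:
`L_{hypRotE s} Φ = Φ ∘ exp(s · (−hypVelE))`. -/
theorem leviCLM_hypRotE_apply (s : ℝ) (Φ : SchwartzMap E6 ℂ) :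
    leviCLM E6 (hypRotE s) Φ = SchwartzMap.compCLMOfContinuousLinearEquiv ℂ (expFlow (-hypVelE) s) Φ := by
  rw [hypRotE_eq_expFlow_apply, leviCLM_expFlow_apply]

/-- pv14-g6's 𝒮-generator of the inverse flow on the Hermite–Schwartz functions:
`flowGen (−hypVelE) (hermiteSchwartz p) = −hermiteSchwartz (hypSymb p)`. -/
theorem flowGen_neg_hypVelE_hermiteSchwartz (p : MvPolynomial MixedVar ℂ) :
    flowGen (-hypVelE) (hermiteSchwartz p) = -hermiteSchwartz (hypSymb p) := by
  ext x
  rw [flowGen_neg_apply', flowGen_hypVelE_hermiteSchwartz]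
  rfl

/-- Through the Bargmann dictionary: `flowGen (−hypVelE) (hermiteSchwartz (binv F)) = −hermiteSchwartz (binv (printedHyp lamF F))`. -/
theorem flowGen_neg_hypVelE_hermiteSchwartz_binv (F : MixedModel) :
    flowGen (-hypVelE) (hermiteSchwartz (binv F)) = -hermiteSchwartz (binv (printedHyp lamF F)) := by
  rw [flowGen_neg_hypVelE_hermiteSchwartz, binv_printedHyp]

/-- **The Σ₁₂ smooth-vector clause for the constructed Levi factor (KERNEL)**: for every polynomial `p`,
`((s:ℂ))⁻¹ • (L_{hypRotE s} (hermiteSchwartz p) − hermiteSchwartz p) → −hermiteSchwartz (hypSymb p)` in `𝓢(E6, ℂ)` as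
`s → 0`, `s ≠ 0`. -/
theorem tendsto_leviCLM_hypRotE_hermiteSchwartz_sub_div (p : MvPolynomial MixedVar ℂ) :
    Tendsto (fun s : ℝ => ((s : ℂ))⁻¹ • (leviCLM E6 (hypRotE s) (hermiteSchwartz p) - hermiteSchwartz p))
      (𝓝[≠] 0) (𝓝 (-hermiteSchwartz (hypSymb p))) := by
  have h := tendsto_leviCLM_expFlow_sub_div_ofReal E6 hypVelE (hermiteSchwartz p)
  rw [flowGen_neg_hypVelE_hermiteSchwartz] at h
  simp only [hypRotE_eq_expFlow_apply]
  exact h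

/-- **Through the Bargmann dictionary (KERNEL)**: on the Schrödinger images `hermiteSchwartz (binv F)` of the Fock
polynomials `F ∈ ℂ[z_a, w_a]` the Schwartz-topology derivative at `s = 0` of `s ↦ L_{hypRotE s} (hermiteSchwartz (binv F))`
is `−hermiteSchwartz (binv (printedHyp lamF F))` — pv12's printed Fock operator of the hyperbolic direction `X₁`
(scaling `lamF = i/π`), transported by `binv`, with the sign of the inverse flow. -/
theorem tendsto_leviCLM_hypRotE_hermiteSchwartz_binv_sub_div (F : MixedModel) :
    Tendsto (fun s : ℝ => ((s : ℂ))⁻¹ •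
        (leviCLM E6 (hypRotE s) (hermiteSchwartz (binv F)) - hermiteSchwartz (binv F)))
      (𝓝[≠] 0) (𝓝 (-hermiteSchwartz (binv (printedHyp lamF F)))) := by
  have h := tendsto_leviCLM_hypRotE_hermiteSchwartz_sub_div (binv F)
  rwa [← binv_printedHyp] at h

/-- The same clause at every base point `s₀` of the subgroup (group law of `expFlow`; pv14-g6's `_at` form):
`((s:ℂ))⁻¹ • (L_{hypRotE (s₀+s)} Φ − L_{hypRotE s₀} Φ) → flowGen (−hypVelE) (L_{hypRotE s₀} Φ)` for `Φ = hermiteSchwartz p`. -/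
theorem tendsto_leviCLM_hypRotE_hermiteSchwartz_sub_div_at (p : MvPolynomial MixedVar ℂ) (s₀ : ℝ) :
    Tendsto (fun s : ℝ => ((s : ℂ))⁻¹ •
        (leviCLM E6 (hypRotE (s₀ + s)) (hermiteSchwartz p) - leviCLM E6 (hypRotE s₀) (hermiteSchwartz p)))
      (𝓝[≠] 0) (𝓝 (flowGen (-hypVelE) (leviCLM E6 (hypRotE s₀) (hermiteSchwartz p)))) := by
  have h := tendsto_leviCLM_expFlow_sub_div_ofReal_at E6 hypVelE (hermiteSchwartz p) s₀
  simp only [← hypRotE_eq_expFlow_apply] at h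
  exact h

/-- **Scalar coefficients are smooth**: for every real-linear continuous `T : 𝓢(E6, ℂ) →L[ℝ] G` and every polynomial `p`,
`s ↦ T (L_{hypRotE s} (hermiteSchwartz p))` has derivative `T (flowGen (−hypVelE) (L_{hypRotE s₀} (hermiteSchwartz p)))`
at every `s₀` (pv14-g6's `hasDerivAt_apply_leviCLM_expFlow` on the hyperbolic subgroup). -/
theorem hasDerivAt_apply_leviCLM_hypRotE {G : Type*} [NormedAddCommGroup G] [NormedSpace ℝ G]
    (T : SchwartzMap E6 ℂ →L[ℝ] G) (p : MvPolynomial MixedVar ℂ) (s₀ : ℝ) :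
    HasDerivAt (fun s : ℝ => T (leviCLM E6 (hypRotE s) (hermiteSchwartz p)))
      (T (flowGen (-hypVelE) (leviCLM E6 (hypRotE s₀) (hermiteSchwartz p)))) s₀ := by
  have h := hasDerivAt_apply_leviCLM_expFlow E6 hypVelE T (hermiteSchwartz p) s₀
  simp only [← hypRotE_eq_expFlow_apply] at h
  exact h

/-- At `s₀ = 0` the scalar derivative is `−T (hermiteSchwartz (hypSymb p))`. -/
theorem hasDerivAt_apply_leviCLM_hypRotE_zero {G : Type*} [NormedAddCommGroup G] [NormedSpace ℝ G]
    (T : SchwartzMap E6 ℂ →L[ℝ] G) (p : MvPolynomial MixedVar ℂ) :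
    HasDerivAt (fun s : ℝ => T (leviCLM E6 (hypRotE s) (hermiteSchwartz p)))
      (-T (hermiteSchwartz (hypSymb p))) 0 := by
  have h := hasDerivAt_apply_leviCLM_hypRotE T p 0
  have h0 : leviCLM E6 (hypRotE 0) (hermiteSchwartz p) = hermiteSchwartz p := by
    rw [hypRotE_eq_expFlow_apply, leviCLM_expFlow_apply]
    ext x
    rw [SchwartzMap.compCLMOfContinuousLinearEquiv_apply]
    show hermiteSchwartz p (expFlow (-hypVelE) 0 x) = hermiteSchwartz p x
    rw [expFlow_zero_apply]
  rw [h0, flowGen_neg_hypVelE_hermiteSchwartz, map_neg] at h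
  exact h

end PrintDict
end Fock
end PerL34
end HodgeCM

end
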